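import Summits.QuantumFields.YangMills.Theorems.UnitScaleTiltFluctuationComparisonRegPrGlobalSlackCanonicalChiIntLLeavesV4
import Summits.QuantumFields.YangMills.Theorems.UnitScaleTiltFluctuationComparisonRegPrGlobalSlackKernelLegOnChiCV4
import Summits.QuantumFields.YangMills.Theorems.UnitScaleTiltFluctuationComparisonRegPrGlobalSlackCanonicalOnChiChiCV4
import Summits.QuantumFields.YangMills.Theorems.UnitScaleTiltFluctuationComparisonRegPrIntLOneSupplier
import Summits.QuantumFields.YangMills.Theorems.UnitScaleTiltProp7PV3CDEAtSPrint
import HarnessLib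

/-!
# `UnitScaleTiltFluctuationComparisonRegPrIntLOneSupplierV4` — THE v4 TWIN (★★OWNER RULING g26-№14 (F-2b); P22b trunk 12, width seat ym-ust-20520-w2 g4; skeleton v5kD) of `…IntLOneSupplier` (§1, §3; §2's T8-from-v8 record-free, imported) — THE DECIDING CRUX `FluctuationComparisonRegPrIntL` FROM 19200's FIVE REGISTERED v8 LEAVES, THE χ-RECORD 2′χ,
# AND ONE BLOCK-SIZE-UNIFORM K1a SUPPLIER PREDICATE (crux stmt-QuantumFields-20520, skeleton v5kC of record since 2026-08-27T23:46Z; width-lever lane B «(R1) print's χ of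
# [Balaban1985UV3] (47) back», seat ym-ust-19935-r1 g5)

WHY.  Skeleton v5kC carries TWO analytic K1a stubs with a block-size split inherited token-for-token from v5g/v5h: 3⁗χ `stub_globalTwoRunSlackFamChiV4` (odd `L ≥ 7`, the
two-cut-off slack row on the whole window) and (i*)χ `stub_smallBlocksSlackOnChiAllChiV4` (odd `1 < L < 7`, the same row on print's χ-good data, every margin `μ`).  The split
records cell FINDING #44/#56 (κ_min√L = 1.66/1.08/0.72 at L = 3/5/7), which concerns the LOWER half of the per-run representation (41)/(47) read on the datum's window —
the row that R-57χ re-typed onto print's χ (`PinnedStep.Fibre57LowOnAC … loPrintAC`, 2′χ) and that E-INT confines to the interior window.  The K1a rows themselves (print's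
UNIFORM displays (43)/(44)/(28)/G3D-01/G3D-06 and the unprinted two-run kernel comparison) mention no block-size threshold, and their full-window forms give the On-χ forms
on every sub-predicate (`…KernelMatchingOn.remainderSmallΦOn_of_full`, `…KernelLegOnChi.cfgDistΦOn_of_full`/`cfgDistCauchyΦOn_of_full`).  Hence ONE supplier predicate,
quantified over every odd `L > 1`, serves both stubs — this file says so BY NAME, in print's leg currency (43)×(44) (`GlobalSlackKernelLeg.K1aLegRowsRChiV4`, lane A's
`K1aLegRowsR` under the χ token map, the target of the w-seats' per-run reference factoring) and in chart currency (`GlobalSlackCanonicalPolymers.K1aChartRowsKChiV4`):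

* §1 `k1aLegRowsROnChiCChiV4_of_RChiV4` (full leg rows ⟹ On-χ leg rows at every margin and every `ε₀`), **`smallBlocksSlackOnChiAllChiV4_of_k1aLegRowsRChiV4_all`** (⟨(i*)χ TEXT⟩ from
  `K1aLegRowsRChiV4` at the odd `1 < L < 7`), `smallBlocksSlackOnChiAllChiV4_of_k1aChartRowsKChiV4_all` (chart twin of ★r1 g4's `…_of_k1aChartRowsCChi_all`);
* §2 **`thm1In8GlobalMin_of_v8Leaves`**: ⟨T8 TEXT⟩ from the FIVE registered stubs of 19200's skeleton v8 (`stub_halvingStep`, `stub_PV3A`, `stub_PV3C`, `stub_PV3D`, `stub_PV3E`, texts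
  VERBATIM) — v8's own `prop7From14_v8` step (`Prop7PV3CDEAtSPrint.prop7From14At_v8` at a trivial Sect. C–E tail) followed by ★r1 g4's `thm1In8GlobalMin_of_v7Leaves`;
* §3 **`regPrIntL_of_v8Leaves_recChiV4_k1aLegRowsRChiV4_allL`** : halving → PV3A → PV3C → PV3D → PV3E → 2′χ → (∀ odd `L > 1`: `∃ a ∈ (0,1), K1aLegRowsRChiV4 L 𝔠 a₀ a₁ a`) →
  `FluctuationComparisonRegPrIntL`, and the chart twin `…_k1aChartRowsKChi_allL` — STUB 1 by `ApproxLift.AnsatzT.stub_oneStepSmallLift`, both K1a stubs by the ONE predicate.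
HONEST FRAMING: compositions of landed theorems; the hypotheses ARE the analytic content ([Balaban1985Variational] Sect. F halving and Props 2/5–6/p.299/(141)–(142); the (α)
record with print's lower row; the K1a two-run kernel comparison with the (43)/(44)/(M1) displays); none of it is asserted here, no numerics, registry untouched
(`--supports stmt-QuantumFields-20520`).  YM₃ on T³ is a rung of the ladder; nothing here is a claim about any stub, the crux, d = 4 or the mass gap.

References: T. Bałaban, CMP 102 (1985) 255–275 [Balaban1985UV3] ((41) p.266, (43)–(47) pp.266–267, (57) p.270, Thm 2 p.272); CMP 102 (1985) 277–309 [Balaban1985Variational]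
(Thm 1 (8) p.279, Prop. 2 p.281, Props 5–6 pp.294–296, Prop. 7 p.299, (141)–(142) p.299, Prop. 8 p.304); C. King, CMP 102 (1986) 649–677 [King1986] (Thm 3.4 (3.9) p.656, Prop. 3.6
(3.56) p.662, Prop. 3.8 (3.71) p.664, Prop. 3.9 (3.73)–(3.75) p.665); T. Bałaban, CMP 109 (1987) 249–301 [Balaban1987RG1] ((0.4) p.253).
-/

set_option autoImplicit false

noncomputable section

/-! ## §1 One block-size-uniform leg predicate serves both χ-stubs -/

namespace Summit.QuantumFields.YangMills.Theorems.GlobalSlackKernelLeg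

open Literature.MathematicalPhysics.QuantumFieldTheory.Balaban1983to89
open Literature.MathematicalPhysics.QuantumFieldTheory.Balaban1983to89.T3ContinuumYM3Torus
open Summit.QuantumFields.Balaban3D.Carriers
open Summit.QuantumFields.Balaban3D.Proofs.Primitives
open Summit.QuantumFields.YangMills.Theorems.GlobalSlackKernelMatchingOn (remainderSmallΦOn_of_full)

/-- **THE FULL-WINDOW LEG ROWS GIVE THE On-χ LEG ROWS AT EVERY MARGIN** (and every `ε₀`): `K1aLegRowsRChiV4 L 𝔠 a₀ a₁ a → K1aLegRowsROnChiCChiV4 L μ 𝔠 a₀ a₁ a` — the three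
configuration/remainder rows restrict from the window to print's χ-good data (`remainderSmallΦOn_of_full`, `cfgDistΦOn_of_full`, `cfgDistCauchyΦOn_of_full`); the kernel rows are
unchanged.  No block-size hypothesis. [cite: Balaban1985UV3, (43)-(44) pp.266-267, (47) p.267] -/
theorem k1aLegRowsROnChiCChiV4_of_RChiV4 {L : ℕ} (μ : ℝ) {𝔠 : AlphaConsts L (suGroupModel 2).N} {a₀ a₁ a : ℝ} (h : K1aLegRowsRChiV4 L 𝔠 a₀ a₁ a) :
    K1aLegRowsROnChiCChiV4 L μ 𝔠 a₀ a₁ a := by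
  obtain ⟨κ', κ₁, C, A, C_R, C_s, C_B, γB, hκ', hκ1, hC, hA, hCR, hCs, hCB, hγB, hall⟩ := h
  refine ⟨κ', κ₁, C, A, C_R, C_s, C_B, γB, hκ', hκ1, hC, hA, hCR, hCs, hCB, hγB, fun F γ hF hγ hγle hγ1 hOf => ?_⟩
  obtain ⟨p, hp, Φ, e, B, hK, hP, hR, hS, hBC⟩ := hall F γ hF hγ hγle hγ1 hOf
  exact ⟨p, hp, fun ε₀ _ _ => ⟨Φ, e, B, hK, hP, remainderSmallΦOn_of_full _ hR, cfgDistΦOn_of_full _ hS, cfgDistCauchyΦOn_of_full _ hBC⟩⟩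

/-- **THE REGISTERED STUB (i*)χ FROM THE FULL-WINDOW LEG ROWS AT THE SMALL BLOCK SIZES, BY NAME**: if `K1aLegRowsRChiV4 L 𝔠 a₀ a₁ a` (3⁗χ's supplier predicate in print's leg
currency) is available at every odd `1 < L < 7`, then the text of `stub_smallBlocksSlackOnChiAllChiV4` (skeleton v5kC of stmt-QuantumFields-20520) holds VERBATIM
(`smallBlocksSlackOnChiAllChiV4_of_k1aLegRowsROnChiCChiV4 ∘ k1aLegRowsROnChiCChiV4_of_RChiV4`). [cite: Balaban1985UV3, (43)-(47) pp.266-267, (57) p.270; King1986, Thm 3.4 (3.9) p.656, Prop. 3.6 p.662] -/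
theorem smallBlocksSlackOnChiAllChiV4_of_k1aLegRowsRChiV4_all
    (h : ∀ (L : ℕ), Odd L → 1 < L → L < 7 → ∀ (𝔠 : AlphaConsts L (suGroupModel 2).N) (a₀ a₁ : ℝ), 0 < a₀ → 0 < a₁ → 𝔠.B₃ * a₁ ≤ a₀ →
      ∃ a : ℝ, 0 < a ∧ a < 1 ∧ K1aLegRowsRChiV4 L 𝔠 a₀ a₁ a) :
    ∀ (L : ℕ), Odd L → 1 < L → L < 7 → ∀ (μ : ℝ), 0 < μ → μ < 1 →
      ∀ (𝔠 : Summit.QuantumFields.Balaban3D.Proofs.Primitives.AlphaConsts L (Summit.QuantumFields.Balaban3D.Carriers.suGroupModel 2).N)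
        (a₀ a₁ : ℝ), 0 < a₀ → 0 < a₁ → 𝔠.B₃ * a₁ ≤ a₀ →
        ∃ a : ℝ, 0 < a ∧ ∃ γB : ℝ, 0 < γB ∧ ∀ (F : T3Family) (γ : ℝ) (hF : F.L = L) (hγ : 0 < γ), γ ≤ γB →
          ∀ (hγ1 : γ ≤ (min (hF ▸ 𝔠).gamma0 1) ^ 2),
            Summit.QuantumFields.YangMills.Theorems.AlphaInputsT3AC.OfV4ChiAt F (hF ▸ 𝔠) a₀ a₁ →
            ∃ (p : ∀ K, Summit.QuantumFields.YangMills.Theorems.AlphaInputsT3AC.PkgAtV4Chi F (hF ▸ 𝔠) γ hγ hγ1 K),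
              (∀ K, (p K).a₀ = a₀ ∧ (p K).a₁ = a₁) ∧
              ∃ (π : Summit.QuantumFields.YangMills.Theorems.AlphaInputsT3AC.PolymerT3 F) (σ : ℕ) (C : ℝ), 7 ≤ σ ∧ 0 ≤ C ∧
                ∀ ε₀ : ℝ, 0 < ε₀ → ε₀ ≤ a₀ →
                  Summit.QuantumFields.YangMills.Theorems.PrintChi.GlobalSupRateTSlackOn
                    (fun K n h V => Summit.QuantumFields.YangMills.Theorems.PrintChi.ChiGood F γ (hF ▸ 𝔠).b₀ (hF ▸ 𝔠).p₀ ε₀ μ (n := n) (K := K) h V)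
                    (Summit.QuantumFields.YangMills.Theorems.AlphaInputsT3AC.dataOfV4chi p π) (hF ▸ 𝔠).b₀ (hF ▸ 𝔠).p₀ a σ C :=
  smallBlocksSlackOnChiAllChiV4_of_k1aLegRowsROnChiCChiV4 fun L hLo hL1 hL7 μ _ _ 𝔠 a₀ a₁ ha0 ha1 hw => by
    obtain ⟨a, ha, ha1', hc⟩ := h L hLo hL1 hL7 𝔠 a₀ a₁ ha0 ha1 hw
    exact ⟨a, ha, ha1', k1aLegRowsROnChiCChiV4_of_RChiV4 μ hc⟩

end Summit.QuantumFields.YangMills.Theorems.GlobalSlackKernelLeg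

namespace Summit.QuantumFields.YangMills.Theorems.GlobalSlackCanonicalOnChi

open Literature.MathematicalPhysics.QuantumFieldTheory.Balaban1983to89
open Literature.MathematicalPhysics.QuantumFieldTheory.Balaban1983to89.T3ContinuumYM3Torus
open Summit.QuantumFields.Balaban3D.Carriers
open Summit.QuantumFields.Balaban3D.Proofs.Primitives
open Summit.QuantumFields.YangMills.Theorems.GlobalSlackCanonicalPolymers (K1aChartRowsKChiV4 k1aChartRowsCChiV4_of_KChiV4)

/-- **THE REGISTERED STUB (i*)χ FROM THE FULL-WINDOW χ-CHART ROWS AT THE RECORD'S DECAY RATE, SMALL BLOCK SIZES, BY NAME**: chart twin of the previous theorem — 3⁗χ's chart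
supplier predicate `K1aChartRowsKChiV4` (no letter on the constants record) at every odd `1 < L < 7` gives the text of `stub_smallBlocksSlackOnChiAllChiV4` VERBATIM
(`smallBlocksSlackOnChiAllChiV4_of_k1aChartRowsCChiV4_all ∘ k1aChartRowsCChiV4_of_KChiV4`). [cite: Balaban1985UV3, (25) p.262, (28)-(30) p.263, (33)-(34) p.264, (43)-(47) pp.266-267; King1986, Thm 3.4 (3.9) p.656, Prop. 3.6 (3.56) p.662] -/
theorem smallBlocksSlackOnChiAllChiV4_of_k1aChartRowsKChiV4_all
    (h : ∀ (L : ℕ), Odd L → 1 < L → L < 7 → ∀ (𝔠 : AlphaConsts L (suGroupModel 2).N) (a₀ a₁ : ℝ), 0 < a₀ → 0 < a₁ → 𝔠.B₃ * a₁ ≤ a₀ →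
      ∃ a : ℝ, 0 < a ∧ a < 1 ∧ K1aChartRowsKChiV4 L 𝔠 a₀ a₁ a) :
    ∀ (L : ℕ), Odd L → 1 < L → L < 7 → ∀ (μ : ℝ), 0 < μ → μ < 1 →
      ∀ (𝔠 : Summit.QuantumFields.Balaban3D.Proofs.Primitives.AlphaConsts L (Summit.QuantumFields.Balaban3D.Carriers.suGroupModel 2).N)
        (a₀ a₁ : ℝ), 0 < a₀ → 0 < a₁ → 𝔠.B₃ * a₁ ≤ a₀ →
        ∃ a : ℝ, 0 < a ∧ ∃ γB : ℝ, 0 < γB ∧ ∀ (F : T3Family) (γ : ℝ) (hF : F.L = L) (hγ : 0 < γ), γ ≤ γB →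
          ∀ (hγ1 : γ ≤ (min (hF ▸ 𝔠).gamma0 1) ^ 2),
            Summit.QuantumFields.YangMills.Theorems.AlphaInputsT3AC.OfV4ChiAt F (hF ▸ 𝔠) a₀ a₁ →
            ∃ (p : ∀ K, Summit.QuantumFields.YangMills.Theorems.AlphaInputsT3AC.PkgAtV4Chi F (hF ▸ 𝔠) γ hγ hγ1 K),
              (∀ K, (p K).a₀ = a₀ ∧ (p K).a₁ = a₁) ∧
              ∃ (π : Summit.QuantumFields.YangMills.Theorems.AlphaInputsT3AC.PolymerT3 F) (σ : ℕ) (C : ℝ), 7 ≤ σ ∧ 0 ≤ C ∧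
                ∀ ε₀ : ℝ, 0 < ε₀ → ε₀ ≤ a₀ →
                  Summit.QuantumFields.YangMills.Theorems.PrintChi.GlobalSupRateTSlackOn
                    (fun K n h V => Summit.QuantumFields.YangMills.Theorems.PrintChi.ChiGood F γ (hF ▸ 𝔠).b₀ (hF ▸ 𝔠).p₀ ε₀ μ (n := n) (K := K) h V)
                    (Summit.QuantumFields.YangMills.Theorems.AlphaInputsT3AC.dataOfV4chi p π) (hF ▸ 𝔠).b₀ (hF ▸ 𝔠).p₀ a σ C :=
  smallBlocksSlackOnChiAllChiV4_of_k1aChartRowsCChiV4_all fun L hLo hL1 hL7 𝔠 a₀ a₁ ha0 ha1 hw => by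
    obtain ⟨a, ha, ha1', hc⟩ := h L hLo hL1 hL7 𝔠 a₀ a₁ ha0 ha1 hw
    exact ⟨a, ha, ha1', k1aChartRowsCChiV4_of_KChiV4 hc⟩

end Summit.QuantumFields.YangMills.Theorems.GlobalSlackCanonicalOnChi

/-! ## §2 (opens) — stub T8 from v8's leaves is `InteriorExcision.thm1In8GlobalMin_of_v8Leaves` of `…IntLOneSupplier` -/

namespace Summit.QuantumFields.YangMills.Theorems.InteriorExcision

open Literature.MathematicalPhysics.QuantumFieldTheory.Balaban1983to89
open Literature.MathematicalPhysics.QuantumFieldTheory.Balaban1983to89.T3ContinuumYM3Torus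
open Literature.MathematicalPhysics.QuantumFieldTheory.Balaban1983to89.T3UnitLawDensityEML (ℰp)
open Literature.MathematicalPhysics.QuantumFieldTheory.Balaban1983to89.T3InteriorExcision
open Literature.MathematicalPhysics.QuantumFieldTheory.Balaban1983to89.T3PrintedRegularMinimiser
open Literature.MathematicalPhysics.QuantumFieldTheory.Balaban1983to89.T3PrintedMinimiserExistence
open Literature.MathematicalPhysics.QuantumFieldTheory.Balaban1983to89.T3ConstrainedMinimiser (fibre)
open Literature.MathematicalPhysics.QuantumFieldTheory.Balaban1983to89.T3LowerAlongMinimisersSplit (MinimisersIn8At)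
open Literature.MathematicalPhysics.QuantumFieldTheory.Balaban1983to89.T3Thm1Carrier (famX Idx)
open Literature.MathematicalPhysics.QuantumFieldTheory.Balaban1983to89.T3Thm1CarrierNative (IsCritR2)
open Literature.MathematicalPhysics.QuantumFieldTheory.Balaban1983to89.T3SectALandauChart (ResidFam famLG3 In19 CloseAvg emb15)
open Literature.MathematicalPhysics.QuantumFieldTheory.Balaban1983to89.B11 (Prop2Printed)
open Summit.QuantumFields.Balaban3D.Carriers
open Summit.QuantumFields.Balaban3D.Proofs.Primitives
open Summit.QuantumFields.YangMills.Theorems.Prop7TPrint (nMax19 expHermField)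
open Summit.QuantumFields.YangMills.Theorems.Prop7SPrint (sPrint RestrictedPrint AvgCondPrint IsLandauPrint CritLPrint)
open Summit.QuantumFields.YangMills.Theorems.GlobalSlackCanonicalPolymers (K1aChartRowsKChiV4 k1aChartRowsCChiV4_of_KChiV4 globalTwoRunSlackFamChiV4_of_k1aChartRowsKChiV4)
open Summit.QuantumFields.YangMills.Theorems.GlobalSlackCanonicalOnChi (smallBlocksSlackOnChiAllChiV4_of_k1aChartRowsKChiV4_all)
open Summit.QuantumFields.YangMills.Theorems.GlobalSlackKernelLeg (K1aLegRowsRChiV4 globalTwoRunSlackFamChiV4_of_k1aLegRowsRChiV4 smallBlocksSlackOnChiAllChiV4_of_k1aLegRowsRChiV4_all)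

-- (`thm1In8GlobalMin_of_v8Leaves` is RECORD-FREE: imported from `…IntLOneSupplier`, not restated.)

/-! ## §3 The deciding crux from v8's five leaves, the χ-record, and ONE block-size-uniform K1a predicate -/

/-- **THE DECIDING CRUX FROM 19200's FIVE v8 LEAVES, THE χ-RECORD AND ONE `L`-UNIFORM SUPPLIER IN PRINT'S LEG CURRENCY**: V2′ (`stub_halvingStep`), P-V3-A/C/D/E (`stub_PV3A`,
`stub_PV3C`, `stub_PV3D`, `stub_PV3E`), 2′χ (`AlphaInputsT3ACv4RecChi L` for every odd `L > 1`), and — for EVERY odd `L > 1`, every constants record and [7]-constants — a rate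
exponent `0 < a < 1` with the five leg rows `K1aLegRowsRChiV4 L 𝔠 a₀ a₁ a` give `FluctuationComparisonRegPrIntL`: STUB 1 by `ApproxLift.AnsatzT.stub_oneStepSmallLift`, T8 by §2,
3⁗χ by `globalTwoRunSlackFamChiV4_of_k1aLegRowsRChiV4` (the predicate at `L ≥ 7`), (i*)χ by `smallBlocksSlackOnChiAllChiV4_of_k1aLegRowsRChiV4_all` (the SAME predicate at `L < 7`), then
★r1 g3's engine `regPrIntL_of_v4ChiStubs`.  No block-size split survives in the hypotheses. [cite: Balaban1985UV3, (41) p.266, (43)-(47) pp.266-267, (57) p.270, Thm 2 p.272; Balaban1985Variational, Thm 1 (8) p.279, Prop. 2 p.281, Props 5-6 pp.294-296, Prop. 7 p.299, (141)-(142) p.299, Prop. 8 p.304; King1986, Thm 3.4 (3.9) p.656, Prop. 3.6 (3.56) p.662, Prop. 3.9 (3.71) p.664; Balaban1987RG1, (0.4) p.253] -/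
theorem regPrIntL_of_v8Leaves_recChiV4_k1aLegRowsRChiV4_allL
    (hV2 : ∀ (L : ℕ), 1 < L → ∃ B₃ : ℝ, 4 < B₃ ∧ ∃ a₅ : ℝ, 0 < a₅ ∧
      ∀ (i : Idx L) (ε₀ ε₁ : ℝ), 0 < ε₁ → ∀ (V : (famX L i).Bdry) (U : (famX L i).Cfg), (famX L i).Reg7 ε₁ V → (famX L i).InU ε₀ U →
        (famX L i).InB V U → (famX L i).IsCritical V U → ε₀ ≤ a₅ → (famX L i).InU (max (B₃ * ε₁) (ε₀ / 2)) U)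
    (hA : ∀ (L : ℕ), 1 < L → ∀ (T : ResidFam L) (B₃ : ℝ), 4 < B₃ →
      ∃ B₁ c₁ : ℝ, 0 < B₁ ∧ 0 < c₁ ∧ Prop2Printed B₁ B₃ ((L : ℝ) ^ 3) c₁ (famLG3 L (sPrint L T)))
    (hC : ∀ (L : ℕ), 1 < L → ∀ (B₃ : ℝ), 4 < B₃ →
      ∃ B₀ a₄ : ℝ, 0 < B₀ ∧ 0 < a₄ ∧ ∀ (i : Idx L) (ε₁ ε₄ : ℝ), 0 < ε₁ → ε₄ ≤ a₄ → 2 * B₀ * (L : ℝ) ^ 3 * B₃ * ε₁ ≤ ε₄ →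
        ∀ (V : GaugeField (i.1.1.P i.1.2.1) 0 (Matrix.specialUnitaryGroup (Fin 2) ℂ))
          (U₀ : GaugeField (i.1.1.P i.1.2.2) 0 (Matrix.specialUnitaryGroup (Fin 2) ℂ)),
          RegPr i.1.1 i.1.2.1 i.1.2.2 ((L : ℝ) ^ 3 * B₃ * ε₁) U₀ → CloseAvg i.1.1 i.1.2.1 i.1.2.2 i.2.2.le ((L : ℝ) ^ 3 * ε₁) V U₀ →
          ∃ X : PBond (i.1.1.P i.1.2.2) 0 → Matrix (Fin 2) (Fin 2) ℂ,
            nMax19 i.1.1 i.1.2.1 i.1.2.2 U₀ X < ε₄ ∧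
            ((∀ b : PBond (i.1.1.P i.1.2.2) 0, (X b).IsHermitian ∧ Matrix.trace (X b) = 0) ∧ AvgCondPrint i.1.1 i.1.2.1 i.1.2.2 i.2.2.le V U₀ X ∧
              IsLandauPrint i.1.1 i.1.2.1 i.1.2.2 U₀ X ∧ CritLPrint i.1.1 i.1.2.1 i.1.2.2 i.2.2.le V U₀ (expHermField X)) ∧
            nMax19 i.1.1 i.1.2.1 i.1.2.2 U₀ X < 3 * B₀ * (L : ℝ) ^ 3 * B₃ * ε₁ ∧
            ∀ X' : PBond (i.1.1.P i.1.2.2) 0 → Matrix (Fin 2) (Fin 2) ℂ, nMax19 i.1.1 i.1.2.1 i.1.2.2 U₀ X' < ε₄ →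
              ((∀ b : PBond (i.1.1.P i.1.2.2) 0, (X' b).IsHermitian ∧ Matrix.trace (X' b) = 0) ∧ AvgCondPrint i.1.1 i.1.2.1 i.1.2.2 i.2.2.le V U₀ X' ∧
                IsLandauPrint i.1.1 i.1.2.1 i.1.2.2 U₀ X' ∧ CritLPrint i.1.1 i.1.2.1 i.1.2.2 i.2.2.le V U₀ (expHermField X')) → X' = X)
    (hD : ∀ (L : ℕ), 1 < L → ∀ (B₃ : ℝ), 4 < B₃ →
      ∃ O₂ c : ℝ, 1 ≤ O₂ ∧ 0 < c ∧ ∀ (i : Idx L) (ε₁ ε₂ : ℝ) (V : GaugeField (i.1.1.P i.1.2.1) 0 (Matrix.specialUnitaryGroup (Fin 2) ℂ))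
        (U₀ U₁ : GaugeField (i.1.1.P i.1.2.2) 0 (Matrix.specialUnitaryGroup (Fin 2) ℂ)) (X : PBond (i.1.1.P i.1.2.2) 0 → Matrix (Fin 2) (Fin 2) ℂ),
        (L : ℝ) ^ 3 * B₃ * ε₁ ≤ ε₂ → ε₂ ≤ c → RegPr i.1.1 i.1.2.1 i.1.2.2 ((L : ℝ) ^ 3 * B₃ * ε₁) U₀ → CloseAvg i.1.1 i.1.2.1 i.1.2.2 i.2.2.le ((L : ℝ) ^ 3 * ε₁) V U₀ →
        In19 i.1.1 i.1.2.1 i.1.2.2 ε₂ U₀ U₁ X → AvgCondPrint i.1.1 i.1.2.1 i.1.2.2 i.2.2.le V U₀ X → IsLandauPrint i.1.1 i.1.2.1 i.1.2.2 U₀ X →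
        CritLPrint i.1.1 i.1.2.1 i.1.2.2 i.2.2.le V U₀ U₁ →
          ∃ u : GaugeTransf (i.1.1.P i.1.2.2) 0 (Matrix.specialUnitaryGroup (Fin 2) ℂ), RestrictedPrint i.1.1 i.1.2.1 i.1.2.2 U₀ u ∧
            RegPr i.1.1 i.1.2.1 i.1.2.2 (O₂ * ε₂) (GaugeField.gaugeAct u (emb15 U₀ U₁)) ∧
            GaugeField.gaugeAct u (emb15 U₀ U₁) ∈ fibre i.1.1 ℰp i.1.2.1 i.1.2.2 i.2.2.le V ∧
            IsCritR2 i.1.1 i.1.2.1 i.1.2.2 i.2.2.le V (GaugeField.gaugeAct u (emb15 U₀ U₁)))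
    (hE : ∀ (L : ℕ), 1 < L → ∀ (B₃ : ℝ), 4 < B₃ →
      ∃ e₅ : ℝ, 0 < e₅ ∧ ∀ (i : Idx L) (e ε₁ : ℝ) (V : GaugeField (i.1.1.P i.1.2.1) 0 (Matrix.specialUnitaryGroup (Fin 2) ℂ))
        (U₀ U₁ : GaugeField (i.1.1.P i.1.2.2) 0 (Matrix.specialUnitaryGroup (Fin 2) ℂ)) (u : GaugeTransf (i.1.1.P i.1.2.2) 0 (Matrix.specialUnitaryGroup (Fin 2) ℂ)),
        e ≤ e₅ → RegPr i.1.1 i.1.2.1 i.1.2.2 ((L : ℝ) ^ 3 * B₃ * ε₁) U₀ → CloseAvg i.1.1 i.1.2.1 i.1.2.2 i.2.2.le ((L : ℝ) ^ 3 * ε₁) V U₀ →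
        CritLPrint i.1.1 i.1.2.1 i.1.2.2 i.2.2.le V U₀ U₁ → RestrictedPrint i.1.1 i.1.2.1 i.1.2.2 U₀ u →
        RegPr i.1.1 i.1.2.1 i.1.2.2 e (GaugeField.gaugeAct u (emb15 U₀ U₁)) →
        GaugeField.gaugeAct u (emb15 U₀ U₁) ∈ fibre i.1.1 ℰp i.1.2.1 i.1.2.2 i.2.2.le V →
        IsCritR2 i.1.1 i.1.2.1 i.1.2.2 i.2.2.le V (GaugeField.gaugeAct u (emb15 U₀ U₁)) →
          GaugeField.gaugeAct u (emb15 U₀ U₁) ∈ regFibrePr i.1.1 i.1.2.1 i.1.2.2 i.2.2.le e V ∧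
          IsMinOn (fun W : GaugeField (i.1.1.P i.1.2.2) 0 (Matrix.specialUnitaryGroup (Fin 2) ℂ) => wilsonAction4 W)
            (regFibrePr i.1.1 i.1.2.1 i.1.2.2 i.2.2.le e V) (GaugeField.gaugeAct u (emb15 U₀ U₁)))
    (h2 : ∀ L : ℕ, Odd L → 1 < L → Summit.QuantumFields.YangMills.Theorems.AlphaInputsT3ACv4RecChi L)
    (hK : ∀ (L : ℕ), Odd L → 1 < L → ∀ (𝔠 : AlphaConsts L (suGroupModel 2).N) (a₀ a₁ : ℝ), 0 < a₀ → 0 < a₁ → 𝔠.B₃ * a₁ ≤ a₀ →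
      ∃ a : ℝ, 0 < a ∧ a < 1 ∧ K1aLegRowsRChiV4 L 𝔠 a₀ a₁ a) :
    FluctuationComparisonRegPrIntL :=
  regPrIntL_of_v4ChiStubs Summit.QuantumFields.YangMills.Theorems.ApproxLift.AnsatzT.stub_oneStepSmallLift (thm1In8GlobalMin_of_v8Leaves hV2 hA hC hD hE) h2
    (globalTwoRunSlackFamChiV4_of_k1aLegRowsRChiV4 fun L hLo h7 𝔠 a₀ a₁ ha0 ha1 hw => hK L hLo (by omega) 𝔠 a₀ a₁ ha0 ha1 hw)
    (smallBlocksSlackOnChiAllChiV4_of_k1aLegRowsRChiV4_all fun L hLo hL1 _ 𝔠 a₀ a₁ ha0 ha1 hw => hK L hLo hL1 𝔠 a₀ a₁ ha0 ha1 hw)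

/-- **THE SAME IN CHART CURRENCY**: the six chart rows at the χ-record's canonical polymerisation and the record's decay rate (`K1aChartRowsKChiV4`, no letter on the record) for
every odd `L > 1` — 3⁗χ by `globalTwoRunSlackFamChiV4_of_k1aChartRowsKChiV4`, (i*)χ by `smallBlocksSlackOnChiAllChiV4_of_k1aChartRowsKChiV4_all`.
[cite: Balaban1985UV3, (25) p.262, (28)-(30) p.263, (33)-(34) p.264, (43)-(47) pp.266-267, Thm 2 p.272; Balaban1985Variational, Thm 1 (8) p.279, Prop. 7 p.299, Prop. 8 p.304; King1986, Thm 3.4 (3.9) p.656, Prop. 3.6 (3.56) p.662; Balaban1987RG1, (0.4) p.253] -/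
theorem regPrIntL_of_v8Leaves_recChiV4_k1aChartRowsKChiV4_allL
    (hV2 : ∀ (L : ℕ), 1 < L → ∃ B₃ : ℝ, 4 < B₃ ∧ ∃ a₅ : ℝ, 0 < a₅ ∧
      ∀ (i : Idx L) (ε₀ ε₁ : ℝ), 0 < ε₁ → ∀ (V : (famX L i).Bdry) (U : (famX L i).Cfg), (famX L i).Reg7 ε₁ V → (famX L i).InU ε₀ U →
        (famX L i).InB V U → (famX L i).IsCritical V U → ε₀ ≤ a₅ → (famX L i).InU (max (B₃ * ε₁) (ε₀ / 2)) U)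
    (hA : ∀ (L : ℕ), 1 < L → ∀ (T : ResidFam L) (B₃ : ℝ), 4 < B₃ →
      ∃ B₁ c₁ : ℝ, 0 < B₁ ∧ 0 < c₁ ∧ Prop2Printed B₁ B₃ ((L : ℝ) ^ 3) c₁ (famLG3 L (sPrint L T)))
    (hC : ∀ (L : ℕ), 1 < L → ∀ (B₃ : ℝ), 4 < B₃ →
      ∃ B₀ a₄ : ℝ, 0 < B₀ ∧ 0 < a₄ ∧ ∀ (i : Idx L) (ε₁ ε₄ : ℝ), 0 < ε₁ → ε₄ ≤ a₄ → 2 * B₀ * (L : ℝ) ^ 3 * B₃ * ε₁ ≤ ε₄ →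
        ∀ (V : GaugeField (i.1.1.P i.1.2.1) 0 (Matrix.specialUnitaryGroup (Fin 2) ℂ))
          (U₀ : GaugeField (i.1.1.P i.1.2.2) 0 (Matrix.specialUnitaryGroup (Fin 2) ℂ)),
          RegPr i.1.1 i.1.2.1 i.1.2.2 ((L : ℝ) ^ 3 * B₃ * ε₁) U₀ → CloseAvg i.1.1 i.1.2.1 i.1.2.2 i.2.2.le ((L : ℝ) ^ 3 * ε₁) V U₀ →
          ∃ X : PBond (i.1.1.P i.1.2.2) 0 → Matrix (Fin 2) (Fin 2) ℂ,
            nMax19 i.1.1 i.1.2.1 i.1.2.2 U₀ X < ε₄ ∧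
            ((∀ b : PBond (i.1.1.P i.1.2.2) 0, (X b).IsHermitian ∧ Matrix.trace (X b) = 0) ∧ AvgCondPrint i.1.1 i.1.2.1 i.1.2.2 i.2.2.le V U₀ X ∧
              IsLandauPrint i.1.1 i.1.2.1 i.1.2.2 U₀ X ∧ CritLPrint i.1.1 i.1.2.1 i.1.2.2 i.2.2.le V U₀ (expHermField X)) ∧
            nMax19 i.1.1 i.1.2.1 i.1.2.2 U₀ X < 3 * B₀ * (L : ℝ) ^ 3 * B₃ * ε₁ ∧
            ∀ X' : PBond (i.1.1.P i.1.2.2) 0 → Matrix (Fin 2) (Fin 2) ℂ, nMax19 i.1.1 i.1.2.1 i.1.2.2 U₀ X' < ε₄ →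
              ((∀ b : PBond (i.1.1.P i.1.2.2) 0, (X' b).IsHermitian ∧ Matrix.trace (X' b) = 0) ∧ AvgCondPrint i.1.1 i.1.2.1 i.1.2.2 i.2.2.le V U₀ X' ∧
                IsLandauPrint i.1.1 i.1.2.1 i.1.2.2 U₀ X' ∧ CritLPrint i.1.1 i.1.2.1 i.1.2.2 i.2.2.le V U₀ (expHermField X')) → X' = X)
    (hD : ∀ (L : ℕ), 1 < L → ∀ (B₃ : ℝ), 4 < B₃ →
      ∃ O₂ c : ℝ, 1 ≤ O₂ ∧ 0 < c ∧ ∀ (i : Idx L) (ε₁ ε₂ : ℝ) (V : GaugeField (i.1.1.P i.1.2.1) 0 (Matrix.specialUnitaryGroup (Fin 2) ℂ))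
        (U₀ U₁ : GaugeField (i.1.1.P i.1.2.2) 0 (Matrix.specialUnitaryGroup (Fin 2) ℂ)) (X : PBond (i.1.1.P i.1.2.2) 0 → Matrix (Fin 2) (Fin 2) ℂ),
        (L : ℝ) ^ 3 * B₃ * ε₁ ≤ ε₂ → ε₂ ≤ c → RegPr i.1.1 i.1.2.1 i.1.2.2 ((L : ℝ) ^ 3 * B₃ * ε₁) U₀ → CloseAvg i.1.1 i.1.2.1 i.1.2.2 i.2.2.le ((L : ℝ) ^ 3 * ε₁) V U₀ →
        In19 i.1.1 i.1.2.1 i.1.2.2 ε₂ U₀ U₁ X → AvgCondPrint i.1.1 i.1.2.1 i.1.2.2 i.2.2.le V U₀ X → IsLandauPrint i.1.1 i.1.2.1 i.1.2.2 U₀ X →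
        CritLPrint i.1.1 i.1.2.1 i.1.2.2 i.2.2.le V U₀ U₁ →
          ∃ u : GaugeTransf (i.1.1.P i.1.2.2) 0 (Matrix.specialUnitaryGroup (Fin 2) ℂ), RestrictedPrint i.1.1 i.1.2.1 i.1.2.2 U₀ u ∧
            RegPr i.1.1 i.1.2.1 i.1.2.2 (O₂ * ε₂) (GaugeField.gaugeAct u (emb15 U₀ U₁)) ∧
            GaugeField.gaugeAct u (emb15 U₀ U₁) ∈ fibre i.1.1 ℰp i.1.2.1 i.1.2.2 i.2.2.le V ∧
            IsCritR2 i.1.1 i.1.2.1 i.1.2.2 i.2.2.le V (GaugeField.gaugeAct u (emb15 U₀ U₁)))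
    (hE : ∀ (L : ℕ), 1 < L → ∀ (B₃ : ℝ), 4 < B₃ →
      ∃ e₅ : ℝ, 0 < e₅ ∧ ∀ (i : Idx L) (e ε₁ : ℝ) (V : GaugeField (i.1.1.P i.1.2.1) 0 (Matrix.specialUnitaryGroup (Fin 2) ℂ))
        (U₀ U₁ : GaugeField (i.1.1.P i.1.2.2) 0 (Matrix.specialUnitaryGroup (Fin 2) ℂ)) (u : GaugeTransf (i.1.1.P i.1.2.2) 0 (Matrix.specialUnitaryGroup (Fin 2) ℂ)),
        e ≤ e₅ → RegPr i.1.1 i.1.2.1 i.1.2.2 ((L : ℝ) ^ 3 * B₃ * ε₁) U₀ → CloseAvg i.1.1 i.1.2.1 i.1.2.2 i.2.2.le ((L : ℝ) ^ 3 * ε₁) V U₀ →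
        CritLPrint i.1.1 i.1.2.1 i.1.2.2 i.2.2.le V U₀ U₁ → RestrictedPrint i.1.1 i.1.2.1 i.1.2.2 U₀ u →
        RegPr i.1.1 i.1.2.1 i.1.2.2 e (GaugeField.gaugeAct u (emb15 U₀ U₁)) →
        GaugeField.gaugeAct u (emb15 U₀ U₁) ∈ fibre i.1.1 ℰp i.1.2.1 i.1.2.2 i.2.2.le V →
        IsCritR2 i.1.1 i.1.2.1 i.1.2.2 i.2.2.le V (GaugeField.gaugeAct u (emb15 U₀ U₁)) →
          GaugeField.gaugeAct u (emb15 U₀ U₁) ∈ regFibrePr i.1.1 i.1.2.1 i.1.2.2 i.2.2.le e V ∧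
          IsMinOn (fun W : GaugeField (i.1.1.P i.1.2.2) 0 (Matrix.specialUnitaryGroup (Fin 2) ℂ) => wilsonAction4 W)
            (regFibrePr i.1.1 i.1.2.1 i.1.2.2 i.2.2.le e V) (GaugeField.gaugeAct u (emb15 U₀ U₁)))
    (h2 : ∀ L : ℕ, Odd L → 1 < L → Summit.QuantumFields.YangMills.Theorems.AlphaInputsT3ACv4RecChi L)
    (hK : ∀ (L : ℕ), Odd L → 1 < L → ∀ (𝔠 : AlphaConsts L (suGroupModel 2).N) (a₀ a₁ : ℝ), 0 < a₀ → 0 < a₁ → 𝔠.B₃ * a₁ ≤ a₀ →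
      ∃ a : ℝ, 0 < a ∧ a < 1 ∧ K1aChartRowsKChiV4 L 𝔠 a₀ a₁ a) :
    FluctuationComparisonRegPrIntL :=
  regPrIntL_of_v4ChiStubs Summit.QuantumFields.YangMills.Theorems.ApproxLift.AnsatzT.stub_oneStepSmallLift (thm1In8GlobalMin_of_v8Leaves hV2 hA hC hD hE) h2
    (globalTwoRunSlackFamChiV4_of_k1aChartRowsKChiV4 fun L hLo h7 𝔠 a₀ a₁ ha0 ha1 hw => hK L hLo (by omega) 𝔠 a₀ a₁ ha0 ha1 hw)
    (smallBlocksSlackOnChiAllChiV4_of_k1aChartRowsKChiV4_all fun L hLo hL1 _ 𝔠 a₀ a₁ ha0 ha1 hw => hK L hLo hL1 𝔠 a₀ a₁ ha0 ha1 hw)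

end Summit.QuantumFields.YangMills.Theorems.InteriorExcision

end
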